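import Literature.Analysis.FluidPDE.Tao2016AveragedNS.SplitCascadeRescaled
import Literature.Analysis.FluidPDE.TaoCascadeRescaledRegime
import HarnessLib

/-!
# The split Prop. 6.5: the regime quantifier `InRegime` (layer 0 of the assembly)

T. Tao, *Finite time blowup for an averaged three-dimensional Navier–Stokes equation*, J. Amer. Math.
Soc. **29** (2016), 601–674 = arXiv:1402.0290v3, §6.4 Prop. 6.5 and the parameter conventions of
§6.1 / Remark 6.6. HONEST FRAMING: statements about the SPLIT cascade model system; nothing here
proves the split Prop. 6.5 and nothing here concerns the true Navier–Stokes equations.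

Split counterpart of `TaoCascadeRescaledRegime.lean`: the datum of the split Prop. 6.5 (Tao's
`RescaledDatum` plus the asymmetries `W` and the profiles `η, β` at the checkpoint), its standing
hypotheses `SplitDatum.Valid γ`, and the regime quantifier `InRegime γ η β P` — "for `0 < ε₀ < 1`
and `C₃ ≥ 0`, for `K` large, `ε` small, all `C₁, C₂ ≥ 0`, `n₀` large, `N ≥ n₀`, and every datum
obeying the split hypotheses (i)–(ix)♯ with profiles `η ε₀ K ε n₀`, `β ε₀ K ε n₀`, the property `P`
holds" — with the quantifier prefix of the cell's obligation `rescaledSplitStepWith γ η β`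
(`SplitCascadeRescaled.lean`), so that `rescaledSplitStepWith γ η β ↔ InRegime γ η β (∃ τ₁ μ₁,
RescaledSplitConclusion …)` definitionally (`rescaledSplitStepWith_iff_inRegime`). The calculus
`mono/and/of_forall/of_K/of_eps/of_n0` is the tree's verbatim; `mono_C₁` records that the split
hypotheses weaken as the error constant `C₁` grows (used to run the bootstrap with a larger error
budget than the datum's, the other part absorbing the asymmetry corrections).

## References

* T. Tao, J. Amer. Math. Soc. 29 (2016), 601–674 = arXiv:1402.0290v3, §6.4 Prop. 6.5, §6.1,
  Remark 6.6. [`Tao2016AveragedNS`]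
-/

noncomputable section

open Set Filter
open scoped _root_.Topology

namespace Literature.Analysis.FluidPDE

namespace Tao2016AveragedNS

open TaoCascade

/-! ## The datum of the split Prop. 6.5 and the regime quantifier -/

/-- **A datum of the split Prop. 6.5**: parameters `ε₀, K, ε`, implied constants `C₁, C₂, C₃`, scales
`n₀ ≤ N`, the profiles `η, β` at the checkpoint, rescaled checkpoint times `τ`, symmetric amplitudes
`Y`, asymmetries `W` and energies `F`. [cite: Tao2016AveragedNS, §6.4 Prop. 6.5] -/
structure SplitDatum where
  /-- the dyadic parameter `ε₀` -/
  ε₀ : ℝ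
  /-- the coupling parameter `K` -/
  K : ℝ
  /-- the parameter `ε` -/
  ε : ℝ
  /-- implied constant of (6.45♯)–(6.48♯), (6.Z1)–(6.Z3) -/
  C₁ : ℝ
  /-- implied constant of (6.51♯) -/
  C₂ : ℝ
  /-- implied constant of (6.53) -/
  C₃ : ℝ
  /-- the initial scale `n₀` -/
  n₀ : ℤ
  /-- the current level `N ≥ n₀` -/
  N : ℤ
  /-- the asymmetry profile at the checkpoint -/
  η : ℤ → ℝ
  /-- the dormant-clock profile at the checkpoint -/
  β : ℕ → ℝ
  /-- rescaled checkpoint times `τ_k` -/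
  τ : ℤ → ℝ
  /-- rescaled symmetric amplitudes `ã_k, b̃_k, c̃_k, d̃_k` -/
  Y : Fin 4 → ℤ → ℝ → ℝ
  /-- rescaled asymmetries `Z̃_{a,k}, Z̃_{c,k}, Z̃_{d,k}` -/
  W : Fin 3 → ℤ → ℝ → ℝ
  /-- rescaled energies `Ẽ_k` -/
  F : ℤ → ℝ → ℝ

namespace SplitDatum

/-- The symmetric part of a split datum as a datum of Tao's Prop. 6.5 (same parameters, `Y`, `F`).
[cite: Tao2016AveragedNS, §6.4 Prop. 6.5] -/
def toRescaledDatum (D : SplitDatum) : RescaledDatum :=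
  ⟨D.ε₀, D.K, D.ε, D.C₁, D.C₂, D.C₃, D.n₀, D.N, D.τ, D.Y, D.F⟩

/-- **Standing hypotheses of §6.5–6.7 for a split datum**: the parameter ranges `0 < ε₀ < 1`,
`K > 0`, `ε > 0`, `C₁, C₂, C₃ ≥ 0`, `n₀ ≤ N`, and the split hypotheses (i)–(ix)♯ with `X₃`-coefficient
`γ(K)`. [cite: Tao2016AveragedNS, §6.4 Prop. 6.5] -/
structure Valid (γ : ℝ → ℝ) (D : SplitDatum) : Prop where
  /-- `0 < ε₀` -/
  ε₀_pos : 0 < D.ε₀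
  /-- `ε₀ < 1` -/
  ε₀_lt_one : D.ε₀ < 1
  /-- `0 < K` -/
  K_pos : 0 < D.K
  /-- `0 < ε` -/
  ε_pos : 0 < D.ε
  /-- `0 ≤ C₁` -/
  C₁_nonneg : 0 ≤ D.C₁
  /-- `0 ≤ C₂` -/
  C₂_nonneg : 0 ≤ D.C₂
  /-- `0 ≤ C₃` -/
  C₃_nonneg : 0 ≤ D.C₃
  /-- `n₀ ≤ N` -/
  n₀_le_N : D.n₀ ≤ D.N
  /-- hypotheses (i)–(ix)♯ of the split Prop. 6.5 -/
  hyp : RescaledSplitHypotheses (γ D.K) D.ε₀ D.K D.ε D.C₁ D.C₂ D.C₃ D.n₀ D.N D.η D.β D.τ D.Y D.W D.F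

end SplitDatum

/-- **"In the regime of the split Prop. 6.5, every datum obeying (i)–(ix)♯ with profiles `η, β`
satisfies `P`"**: for `0 < ε₀ < 1` and `C₃ ≥ 0`, for `K` large, `ε` small, all `C₁, C₂ ≥ 0`, `n₀`
large, `N ≥ n₀` and all `τ, Y, W, F` obeying `RescaledSplitHypotheses (γ K) … (η ε₀ K ε n₀) (β ε₀ K ε n₀) …`,
the property `P` of the datum holds. [cite: Tao2016AveragedNS, §6.4 Prop. 6.5] -/
def InRegime (γ : ℝ → ℝ) (η : ℝ → ℝ → ℝ → ℤ → ℤ → ℝ) (β : ℝ → ℝ → ℝ → ℤ → ℕ → ℝ)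
    (P : SplitDatum → Prop) : Prop :=
  ∀ ε₀ : ℝ, 0 < ε₀ → ε₀ < 1 → ∀ C₃ : ℝ, 0 ≤ C₃ →
    ∃ K₀ : ℝ, ∀ K : ℝ, K₀ ≤ K → 0 < K →
      ∃ e₀ : ℝ, 0 < e₀ ∧ ∀ ε : ℝ, 0 < ε → ε ≤ e₀ →
        ∀ C₁ C₂ : ℝ, 0 ≤ C₁ → 0 ≤ C₂ →
          ∃ N₀ : ℤ, ∀ n₀ : ℤ, N₀ ≤ n₀ → ∀ N : ℤ, n₀ ≤ N →
            ∀ (τ : ℤ → ℝ) (Y : Fin 4 → ℤ → ℝ → ℝ) (W : Fin 3 → ℤ → ℝ → ℝ) (F : ℤ → ℝ → ℝ),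
              RescaledSplitHypotheses (γ K) ε₀ K ε C₁ C₂ C₃ n₀ N (η ε₀ K ε n₀) (β ε₀ K ε n₀)
                  τ Y W F →
                P ⟨ε₀, K, ε, C₁, C₂, C₃, n₀, N, η ε₀ K ε n₀, β ε₀ K ε n₀, τ, Y, W, F⟩

/-- The split Prop. 6.5 (`rescaledSplitStepWith γ η β`) is the `InRegime` statement of its conclusion
(definitionally). [cite: Tao2016AveragedNS, §6.4 Prop. 6.5] -/
theorem rescaledSplitStepWith_iff_inRegime (γ : ℝ → ℝ) (η : ℝ → ℝ → ℝ → ℤ → ℤ → ℝ)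
    (β : ℝ → ℝ → ℝ → ℤ → ℕ → ℝ) :
    rescaledSplitStepWith γ η β ↔
      InRegime γ η β fun D => ∃ τ₁ μ₁ : ℝ,
        RescaledSplitConclusion (γ D.K) D.ε₀ D.K D.ε D.n₀ D.η D.β D.Y D.W D.F τ₁ μ₁ :=
  Iff.rfl

namespace InRegime

variable {γ : ℝ → ℝ} {η : ℝ → ℝ → ℝ → ℤ → ℤ → ℝ} {β : ℝ → ℝ → ℝ → ℤ → ℕ → ℝ}
  {P Q : SplitDatum → Prop}

/-- **Monotonicity**: a pointwise implication valid for every datum obeying the standing hypotheses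
transports `InRegime`. [cite: Tao2016AveragedNS, §6.4 Prop. 6.5] -/
theorem mono (hPQ : ∀ D : SplitDatum, D.Valid γ → P D → Q D) (h : InRegime γ η β P) :
    InRegime γ η β Q := by
  intro ε₀ hε₀ hε₀1 C₃ hC₃
  obtain ⟨K₀, hK⟩ := h ε₀ hε₀ hε₀1 C₃ hC₃
  refine ⟨K₀, fun K hK₀K hKpos => ?_⟩
  obtain ⟨e₀, he₀, hε⟩ := hK K hK₀K hKpos
  refine ⟨e₀, he₀, fun ε hεpos hεle C₁ C₂ hC₁ hC₂ => ?_⟩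
  obtain ⟨N₀, hN⟩ := hε ε hεpos hεle C₁ C₂ hC₁ hC₂
  refine ⟨N₀, fun n₀ hn₀ N hN' τ Y W F hyp => ?_⟩
  exact hPQ _ ⟨hε₀, hε₀1, hKpos, hεpos, hC₁, hC₂, hC₃, hN', hyp⟩ (hN n₀ hn₀ N hN' τ Y W F hyp)

/-- **Conjunction**: two regime statements hold simultaneously in the regime (larger `K₀`, smaller
`e₀`, larger `N₀`). [cite: Tao2016AveragedNS, §6.4 Prop. 6.5] -/
theorem and (hP : InRegime γ η β P) (hQ : InRegime γ η β Q) :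
    InRegime γ η β fun D => P D ∧ Q D := by
  intro ε₀ hε₀ hε₀1 C₃ hC₃
  obtain ⟨K₁, hK₁⟩ := hP ε₀ hε₀ hε₀1 C₃ hC₃
  obtain ⟨K₂, hK₂⟩ := hQ ε₀ hε₀ hε₀1 C₃ hC₃
  refine ⟨max K₁ K₂, fun K hK hKpos => ?_⟩
  obtain ⟨e₁, he₁, h₁⟩ := hK₁ K ((le_max_left _ _).trans hK) hKpos
  obtain ⟨e₂, he₂, h₂⟩ := hK₂ K ((le_max_right _ _).trans hK) hKpos
  refine ⟨min e₁ e₂, lt_min he₁ he₂, fun ε hεpos hεle C₁ C₂ hC₁ hC₂ => ?_⟩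
  obtain ⟨N₁, hN₁⟩ := h₁ ε hεpos (hεle.trans (min_le_left _ _)) C₁ C₂ hC₁ hC₂
  obtain ⟨N₂, hN₂⟩ := h₂ ε hεpos (hεle.trans (min_le_right _ _)) C₁ C₂ hC₁ hC₂
  refine ⟨max N₁ N₂, fun n₀ hn₀ N hN' τ Y W F hyp => ⟨?_, ?_⟩⟩
  · exact hN₁ n₀ ((le_max_left _ _).trans hn₀) N hN' τ Y W F hyp
  · exact hN₂ n₀ ((le_max_right _ _).trans hn₀) N hN' τ Y W F hyp

/-- A property of all valid data holds in the regime. [cite: Tao2016AveragedNS, §6.4 Prop. 6.5] -/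
theorem of_forall (h : ∀ D : SplitDatum, D.Valid γ → P D) : InRegime γ η β P := by
  intro ε₀ hε₀ hε₀1 C₃ hC₃
  refine ⟨0, fun K _ hKpos => ⟨1, one_pos, fun ε hεpos _ C₁ C₂ hC₁ hC₂ => ⟨0, ?_⟩⟩⟩
  intro n₀ _ N hN' τ Y W F hyp
  exact h _ ⟨hε₀, hε₀1, hKpos, hεpos, hC₁, hC₂, hC₃, hN', hyp⟩

/-- **"`K` sufficiently large depending on `ε₀` (and `C₃`)"**: a condition on `K` that holds
eventually at `+∞` for each `ε₀, C₃` holds in the regime. [cite: Tao2016AveragedNS, §6.4 Prop. 6.5] -/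
theorem of_K {p : ℝ → ℝ → ℝ → Prop}
    (hp : ∀ ε₀ C₃ : ℝ, 0 < ε₀ → ε₀ < 1 → 0 ≤ C₃ → ∀ᶠ K in atTop, p ε₀ C₃ K) :
    InRegime γ η β fun D => p D.ε₀ D.C₃ D.K := by
  intro ε₀ hε₀ hε₀1 C₃ hC₃
  obtain ⟨K₀, hK₀⟩ := eventually_atTop.1 (hp ε₀ C₃ hε₀ hε₀1 hC₃)
  refine ⟨K₀, fun K hK _ => ⟨1, one_pos, fun ε _ _ C₁ C₂ _ _ => ⟨0, ?_⟩⟩⟩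
  intro n₀ _ N _ τ Y W F _
  exact hK₀ K hK

/-- **"`ε` sufficiently small depending on `ε₀, K` (and `C₃`)"**: a condition on `ε` that holds
eventually at `0⁺` for each `ε₀, C₃, K > 0` holds in the regime. [cite: Tao2016AveragedNS, §6.4 Prop. 6.5] -/
theorem of_eps {p : ℝ → ℝ → ℝ → ℝ → Prop}
    (hp : ∀ ε₀ C₃ K : ℝ, 0 < ε₀ → ε₀ < 1 → 0 ≤ C₃ → 0 < K →
      ∀ᶠ ε in 𝓝[>] (0 : ℝ), p ε₀ C₃ K ε) :
    InRegime γ η β fun D => p D.ε₀ D.C₃ D.K D.ε := by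
  intro ε₀ hε₀ hε₀1 C₃ hC₃
  refine ⟨0, fun K _ hKpos => ?_⟩
  obtain ⟨e₀, he₀, h⟩ := (nhdsGT_basis_Ioc (0 : ℝ)).eventually_iff.1 (hp ε₀ C₃ K hε₀ hε₀1 hC₃ hKpos)
  refine ⟨e₀, he₀, fun ε hεpos hεle C₁ C₂ _ _ => ⟨0, ?_⟩⟩
  intro n₀ _ N _ τ Y W F _
  exact h ⟨hεpos, hεle⟩

/-- **"`n₀` sufficiently large depending on `ε₀, K, ε` and the implied constants"**: a condition on
`n₀` that holds eventually at `+∞` for all admissible `ε₀, K, ε, C₁, C₂, C₃` holds in the regime.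
[cite: Tao2016AveragedNS, §6.4 Prop. 6.5] -/
theorem of_n0 {p : ℝ → ℝ → ℝ → ℝ → ℝ → ℝ → ℤ → Prop}
    (hp : ∀ ε₀ K ε C₁ C₂ C₃ : ℝ, 0 < ε₀ → ε₀ < 1 → 0 < K → 0 < ε → 0 ≤ C₁ → 0 ≤ C₂ → 0 ≤ C₃ →
      ∀ᶠ n₀ : ℤ in atTop, p ε₀ K ε C₁ C₂ C₃ n₀) :
    InRegime γ η β fun D => p D.ε₀ D.K D.ε D.C₁ D.C₂ D.C₃ D.n₀ := by
  intro ε₀ hε₀ hε₀1 C₃ hC₃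
  refine ⟨0, fun K _ hKpos => ⟨1, one_pos, fun ε hεpos _ C₁ C₂ hC₁ hC₂ => ?_⟩⟩
  obtain ⟨N₀, hN₀⟩ := eventually_atTop.1 (hp ε₀ K ε C₁ C₂ C₃ hε₀ hε₀1 hKpos hεpos hC₁ hC₂ hC₃)
  exact ⟨N₀, fun n₀ hn₀ N _ τ Y W F _ => hN₀ n₀ hn₀⟩

end InRegime

/-! ## Weakening the error constant -/

section Mono

variable {γ ε₀ K ε C₁ C₁' C₂ C₃ : ℝ} {n₀ N : ℤ} {ηp : ℤ → ℝ} {βp : ℕ → ℝ} {τ : ℤ → ℝ}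
  {Y : Fin 4 → ℤ → ℝ → ℝ} {W : Fin 3 → ℤ → ℝ → ℝ} {F : ℤ → ℝ → ℝ}

/-- **The split hypotheses weaken as the error constant grows**: (6.45♯)–(6.48♯) and (6.Z1)–(6.Z3)
with implied constant `C₁` imply the same with any `C₁' ≥ C₁` (all other clauses do not involve
`C₁`). This lets the bootstrap run with an error budget larger than the datum's, the surplus
absorbing the asymmetry corrections. [cite: Tao2016AveragedNS, §6.4 Prop. 6.5 (ii)] -/
theorem RescaledSplitHypotheses.mono_C₁
    (h : RescaledSplitHypotheses γ ε₀ K ε C₁ C₂ C₃ n₀ N ηp βp τ Y W F) (hε₀ : -1 < ε₀)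
    (hC : C₁ ≤ C₁') : RescaledSplitHypotheses γ ε₀ K ε C₁' C₂ C₃ n₀ N ηp βp τ Y W F := by
  have hw : ∀ (k : ℤ) (t : ℝ), τ (n₀ - N) ≤ t →
      C₁ * (1 + ε₀) ^ ((2 : ℝ) * k - n₀ / 2) * Real.sqrt (F k t) ≤
        C₁' * (1 + ε₀) ^ ((2 : ℝ) * k - n₀ / 2) * Real.sqrt (F k t) := fun k t ht =>
    mul_le_mul_of_nonneg_right (mul_le_mul_of_nonneg_right hC (Real.rpow_nonneg (by linarith) _))
      (Real.sqrt_nonneg _)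
  exact { h with
    eq1 := fun k t ht => (h.eq1 k t ht).trans (hw k t ht)
    eq2 := fun k t ht => (h.eq2 k t ht).trans (hw k t ht)
    eq3 := fun k t ht => (h.eq3 k t ht).trans (hw k t ht)
    eq4 := fun k t ht => (h.eq4 k t ht).trans (hw k t ht)
    eqZ1 := fun k t ht => (h.eqZ1 k t ht).trans (hw k t ht)
    eqZ2 := fun k t ht => (h.eqZ2 k t ht).trans (hw k t ht)
    eqZ3 := fun k t ht => (h.eqZ3 k t ht).trans (hw k t ht) }

end Mono

end Tao2016AveragedNS

end Literature.Analysis.FluidPDE
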